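import Summits.ValiantsHypothesis.ValiantsHypothesis.Theorems.LacunarySymmetroidMatrixDescartesDoorA26WallBubblingClassMoments

/-!
# Wall bubbling for `DoorA26` — (W) chain piece: VANDERMONDE CONSTANTS at a generic Weyl face (item (ii))

HONEST FRAMING.  Chain lemma for obligation (W) `stub_weylFaces` of `Cruxes/DoorA26/Lines/wall_bubbling.lean` (stmt-ValiantsHypothesis-19979
`DoorA26`; OPEN, typed, never asserted), re-pointed seat val-sym-door-p1 g13 (W2 #12).  The hypothesis `hV` («Vandermonde control of the
coefficients by the moments», constant `K`) of W2 #10/#11 `levelSelection_class` / `classTail_tendsto_zero`, DISCHARGED for the two merging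
configurations of a generic Weyl face after merging equal-exponent members: the DOUBLETON class `ε = (0, w)` with `K = 1` and the TRIPLE class
`ε = (0, w, 2w)` with `K = 3` (`0 < w ≤ 1`), in exactly the shape `|a i|·w^{n−1} ≤ K·Σ_{m<n} |Σ_{i'} a i'·(ε i')^m|`.  No new definitions; nothing
here bears on `DoorA26`, `MatrixDescartes` (stmt-ValiantsHypothesis-18050) or `VP ≠ VNP`.

[folklore] Explicit inversion of 2×2 / 3×3 Vandermonde systems.
-/

-- `Summit.ValiantsHypothesis.ValiantsHypothesis.…` repeats a component by the D-0017 layout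
-- (single-conjunct summit), which the `dupNamespace` linter flags; the name is mandated.
set_option linter.dupNamespace false

namespace Summit.ValiantsHypothesis.ValiantsHypothesis.Theorems.LacunarySymmetroidMatrixDescartes.WallBubbling

open Finset
open scoped BigOperators

/-- Doubleton class `ε = (0, w)`, `0 < w ≤ 1`: Vandermonde control with `K = 1`. [folklore] -/
theorem vandermonde_doubleton (a : Fin 2 → ℝ) (w : ℝ) (hw : 0 < w) (hw1 : w ≤ 1) (i : Fin 2) :
    |a i| * w ^ (2 - 1) ≤ 1 * ∑ m ∈ Finset.range 2, |∑ i', a i' * (![0, w] i') ^ m| := by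
  have hM : ∑ m ∈ Finset.range 2, |∑ i', a i' * (![0, w] i') ^ m| = |a 0 + a 1| + |a 1 * w| := by
    simp [Finset.sum_range_succ, Fin.sum_univ_two]
  rw [hM, one_mul]
  simp only [show (2 - 1 : ℕ) = 1 from rfl, pow_one]
  have h1 : |a 1| * w = |a 1 * w| := by rw [abs_mul, abs_of_pos hw]
  fin_cases i
  · -- `|a 0| w ≤ (|a 0 + a 1| + |a 1|) w ≤ |a 0 + a 1| + |a 1 w|`
    have h0 : |a 0| ≤ |a 0 + a 1| + |a 1| := by
      calc |a 0| = |(a 0 + a 1) - a 1| := by ring_nf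
        _ ≤ |a 0 + a 1| + |a 1| := abs_sub _ _
    have hA : 0 ≤ |a 0 + a 1| := abs_nonneg _
    calc |a 0| * w ≤ (|a 0 + a 1| + |a 1|) * w := mul_le_mul_of_nonneg_right h0 hw.le
      _ = |a 0 + a 1| * w + |a 1| * w := by ring
      _ ≤ |a 0 + a 1| * 1 + |a 1| * w := by nlinarith
      _ = |a 0 + a 1| + |a 1 * w| := by rw [mul_one, h1]
  · show |a 1| * w ≤ |a 0 + a 1| + |a 1 * w|
    rw [h1]; linarith [abs_nonneg (a 0 + a 1)]

/-- Triple class `ε = (0, w, 2w)`, `0 < w ≤ 1`: Vandermonde control with `K = 3`. [folklore] -/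
theorem vandermonde_triple (a : Fin 3 → ℝ) (w : ℝ) (hw : 0 < w) (hw1 : w ≤ 1) (i : Fin 3) :
    |a i| * w ^ (3 - 1) ≤ 3 * ∑ m ∈ Finset.range 3, |∑ i', a i' * (![0, w, 2 * w] i') ^ m| := by
  -- the three moments
  set M0 := a 0 + a 1 + a 2 with hM0
  set M1 := (a 1 + 2 * a 2) * w with hM1
  set M2 := (a 1 + 4 * a 2) * w ^ 2 with hM2
  have hM : ∑ m ∈ Finset.range 3, |∑ i', a i' * (![0, w, 2 * w] i') ^ m| = |M0| + |M1| + |M2| := by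
    simp only [Finset.sum_range_succ, Finset.range_zero, Finset.sum_empty, zero_add, Fin.sum_univ_three,
      Matrix.cons_val_zero, Matrix.cons_val_one, Matrix.cons_val_two, Matrix.head_cons, Matrix.tail_cons, hM0, hM1, hM2]
    congr 1
    · congr 1
      · congr 1; ring
      · congr 1; ring
    · congr 1; ring
  rw [hM]
  simp only [show (3 - 1 : ℕ) = 2 from rfl]
  have hw2 : 0 < w ^ 2 := by positivity
  have hw21 : w ^ 2 ≤ 1 := by nlinarith
  -- inversion: a2 w² = (M2 − M1 w)/2, a1 w² = 2 M1 w − M2, a0 w² = M0 w² − a1 w² − a2 w²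
  have e2 : a 2 * w ^ 2 = (M2 - M1 * w) / 2 := by rw [hM1, hM2]; ring
  have e1 : a 1 * w ^ 2 = 2 * (M1 * w) - M2 := by rw [hM1, hM2]; ring
  have e0 : a 0 * w ^ 2 = M0 * w ^ 2 - (2 * (M1 * w) - M2) - (M2 - M1 * w) / 2 := by rw [hM0, hM1, hM2]; ring
  have hM1w : |M1 * w| ≤ |M1| := by
    rw [abs_mul, abs_of_pos hw]; exact mul_le_of_le_one_right (abs_nonneg _) hw1
  have hM0w : |M0 * w ^ 2| ≤ |M0| := by
    rw [abs_mul, abs_of_pos hw2]; exact mul_le_of_le_one_right (abs_nonneg _) hw21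
  have b2 : |a 2| * w ^ 2 ≤ |M1| + |M2| := by
    rw [← abs_of_pos hw2, ← abs_mul, e2, abs_div, abs_two]
    have := abs_sub M2 (M1 * w)
    have h := abs_nonneg M2
    have h' := abs_nonneg M1
    have h'' := abs_nonneg (M1 * w)
    linarith
  have b1 : |a 1| * w ^ 2 ≤ 2 * |M1| + |M2| := by
    rw [← abs_of_pos hw2, ← abs_mul, e1]
    calc |2 * (M1 * w) - M2| ≤ |2 * (M1 * w)| + |M2| := abs_sub _ _
      _ = 2 * |M1 * w| + |M2| := by rw [abs_mul, abs_two]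
      _ ≤ 2 * |M1| + |M2| := by linarith
  have b0 : |a 0| * w ^ 2 ≤ |M0| + 3 * |M1| + 2 * |M2| := by
    rw [← abs_of_pos hw2, ← abs_mul, e0]
    calc |M0 * w ^ 2 - (2 * (M1 * w) - M2) - (M2 - M1 * w) / 2|
        ≤ |M0 * w ^ 2 - (2 * (M1 * w) - M2)| + |(M2 - M1 * w) / 2| := abs_sub _ _
      _ ≤ (|M0 * w ^ 2| + |2 * (M1 * w) - M2|) + |(M2 - M1 * w) / 2| := by linarith [abs_sub (M0 * w ^ 2) (2 * (M1 * w) - M2)]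
      _ ≤ (|M0| + (2 * |M1| + |M2|)) + (|M1| + |M2|) / 2 := by
          have h3 : |2 * (M1 * w) - M2| ≤ 2 * |M1| + |M2| := by
            calc |2 * (M1 * w) - M2| ≤ |2 * (M1 * w)| + |M2| := abs_sub _ _
              _ = 2 * |M1 * w| + |M2| := by rw [abs_mul, abs_two]
              _ ≤ 2 * |M1| + |M2| := by linarith
          have h4 : |(M2 - M1 * w) / 2| ≤ (|M1| + |M2|) / 2 := by
            rw [abs_div, abs_two]
            have := abs_sub M2 (M1 * w)
            linarith
          linarith
      _ ≤ |M0| + 3 * |M1| + 2 * |M2| := by linarith [abs_nonneg M1, abs_nonneg M2]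
  have hpos : 0 ≤ |M0| ∧ 0 ≤ |M1| ∧ 0 ≤ |M2| := ⟨abs_nonneg _, abs_nonneg _, abs_nonneg _⟩
  fin_cases i
  · show |a 0| * w ^ 2 ≤ 3 * (|M0| + |M1| + |M2|); linarith [hpos.1, hpos.2.1, hpos.2.2]
  · show |a 1| * w ^ 2 ≤ 3 * (|M0| + |M1| + |M2|); linarith [hpos.1, hpos.2.1, hpos.2.2]
  · show |a 2| * w ^ 2 ≤ 3 * (|M0| + |M1| + |M2|); linarith [hpos.1, hpos.2.1, hpos.2.2]

end Summit.ValiantsHypothesis.ValiantsHypothesis.Theorems.LacunarySymmetroidMatrixDescartes.WallBubbling
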